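import Literature.NumberTheory.LFunctions.DworkRationalityDworkLemma
import Literature.NumberTheory.EllipticCurves.ModularParametrizationCongruenceHondaProofs
import Literature.NumberTheory.EllipticCurves.PadicSeriesEvaluation
import Mathlib.RingTheory.PowerSeries.Expand
import Mathlib.RingTheory.PowerSeries.Binomial
import Mathlib.FieldTheory.Finite.Basic
import HarnessLib

/-!
# The `2`-adic square-class criterion for power series (K-ETA Lemma 1 at `(K, A, σ) = (ℚ₂, ℤ₂, id)`)

Planner p2 GEN 36 (landed by lead star-p1 GEN 12), cell bsd-rank2; crux `StarGO2Sigma` (stmt-BirchSwinnertonDyer-27046), the last step of the proof of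
the η-Kummer square law (K-ETA.md §4, Lemma 1): **for `u ∈ 1 + qℤ₂⟦q⟧`, `u` is the square of a `2`-integral series
iff `u(q²) ≡ u(q)² (mod 4)`** (`isSquare_iff_expand_sub_sq`).  Equivalently the class
`D(u) := (u(q²) − u²)/(2u²) mod 2` vanishes; `D` is a homomorphism with kernel the squares.

* `exists_expand_sub_sq_eq_two_mul` — for integral `B`: `B(q²) − B² ∈ 2ℤ₂⟦q⟧` (Frobenius on `𝔽₂⟦q⟧`, Mathlib
  `MvPowerSeries.map_frobenius_expand`);
* `norm_coeff_expand_sub_sq_le_of_sq` — (⇒): `u = B²`, `B` integral ⇒ `u(q²) − u² = (B(q²) − B²)(B(q²) + B²) ∈ 4ℤ₂⟦q⟧`;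
* `isPadicInt_of_sq_eq` — (⇐): if `u(q²) ≡ u² (mod 4)` then every square root `B` of `u` with `B(0) = 1` is integral:
  `G := B(q²)/u` has `G² = u(q²)/u² = 1 + 4H`, `H` integral, so `G = 1 + 2t` with `t + t² = H`, `t` integral by
  induction on coefficients, and DWORK'S LEMMA (tree `Literature.NumberTheory.LFunctions.Dwork.norm_coeff_le_one_of_expand_eq`:
  `B(q²) = B²·G`, `G ∈ 1 + 2qℤ₂⟦q⟧ ⇒ B ∈ ℤ₂⟦q⟧`) concludes;
* `exists_sqrt` — a square root with constant term `1` exists (binomial series, as in the tree's `FormalSqrtAtTwo`);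
* `isSquare_mul_iff` — the relative form `D(uv) = D(u) + D(v)`: `u·v` is a square iff `u(q²)v² ≡ u²v(q²) (mod 4)`.

No definitions of record; nothing here reads `r_an`; BSD is not proved by this file.
-/

set_option linter.dupNamespace false
set_option autoImplicit false

noncomputable section

open PowerSeries
open Literature.NumberTheory.EllipticCurves

namespace Summit.BirchSwinnertonDyer.BirchSwinnertonDyer.Theorems.DepletionAtTwo.KEta.SqClass

/-! ### §0 `2`-adic helpers -/

/-- An integral `2`-adic series whose reduction mod `2` vanishes has all coefficients of norm `≤ ½`. [folklore] -/
theorem norm_coeff_le_half_of_map_toZMod_eq_zero (D : ℤ_[2]⟦X⟧)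
    (hD : D.map (PadicInt.toZMod (p := 2)) = 0) (n : ℕ) : ‖((coeff n D : ℤ_[2]) : ℚ_[2])‖ ≤ 2⁻¹ := by
  have h1 : PadicInt.toZMod (coeff n D) = 0 := by
    have := congrArg (coeff n) hD
    rwa [coeff_map, map_zero] at this
  have h2 : coeff n D ∈ IsLocalRing.maximalIdeal ℤ_[2] := by
    rw [← PadicInt.ker_toZMod]; exact h1
  have h3 : ‖coeff n D‖ < 1 := PadicInt.mem_nonunits.mp h2
  have key : ∀ x : ℚ_[2], ‖x‖ < 1 → ‖x‖ ≤ 2⁻¹ := fun x hx ↦ by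
    have := (Padic.norm_le_pow_iff_norm_lt_pow_add_one x (-1)).mpr (by simpa using hx)
    simpa using this
  exact key _ (by rwa [PadicInt.norm_def] at h3)

/-! ### §1 Frobenius mod 2: `B(q²) − B² ∈ 2ℤ₂⟦q⟧` -/

/-- For an integral `B ∈ ℚ₂⟦q⟧`: `B(q²) − B(q)² = 2e` with `e` integral (the Frobenius of `𝔽₂⟦q⟧`). [folklore] -/
theorem exists_expand_sub_sq_eq_two_mul {B : ℚ_[2]⟦X⟧} (hB : IsPadicInt B) :
    ∃ e : ℚ_[2]⟦X⟧, IsPadicInt e ∧ expand 2 two_ne_zero B - B ^ 2 = 2 * e := by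
  obtain ⟨B', hB'⟩ := isPadicInt_iff_exists_powerSeries_map.mp hB
  set D : ℤ_[2]⟦X⟧ := expand 2 two_ne_zero B' - B' ^ 2 with hDdef
  have hbar : expand 2 two_ne_zero (B'.map (PadicInt.toZMod (p := 2))) =
      (B'.map (PadicInt.toZMod (p := 2))) ^ 2 := by
    have hfrob : (expand 2 two_ne_zero (B'.map (PadicInt.toZMod (p := 2)))).map (frobenius (ZMod 2) 2) =
        (B'.map (PadicInt.toZMod (p := 2))) ^ 2 :=
      MvPowerSeries.map_frobenius_expand 2 two_ne_zero
    rw [ZMod.frobenius_zmod] at hfrob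
    simpa using hfrob
  have hD : D.map (PadicInt.toZMod (p := 2)) = 0 := by
    rw [hDdef, map_sub, map_pow, map_expand, hbar, sub_self]
  have hDQ : expand 2 two_ne_zero B - B ^ 2 = D.map (PadicInt.Coe.ringHom (p := 2)) := by
    rw [hDdef, map_sub, map_pow, map_expand, hB']
  refine ⟨C (2⁻¹ : ℚ_[2]) * (expand 2 two_ne_zero B - B ^ 2), ?_, ?_⟩
  · refine isPadicInt_iff_coeff.mpr fun n ↦ ?_
    rw [coeff_C_mul, hDQ, coeff_map, norm_mul, norm_inv, show ‖(2 : ℚ_[2])‖ = 2⁻¹ by simpa using Padic.norm_p (p := 2),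
      inv_inv]
    have := norm_coeff_le_half_of_map_toZMod_eq_zero D hD n
    have h' : ‖(PadicInt.Coe.ringHom (p := 2)) (coeff n D)‖ ≤ 2⁻¹ := by simpa using this
    linarith
  · rw [← mul_assoc, show (2 : ℚ_[2]⟦X⟧) = C (2 : ℚ_[2]) from (map_ofNat C 2).symm, ← map_mul,
      mul_inv_cancel₀ (two_ne_zero), map_one, one_mul]

/-! ### §2 (⇒) squares satisfy `u(q²) ≡ u² (mod 4)` -/

/-- If `u = B²` with `B ∈ ℤ₂⟦q⟧` then `u(q²) − u(q)² ∈ 4ℤ₂⟦q⟧`. [this memo, K-ETA.md §4 Lemma 1 (⇒)] -/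
theorem norm_coeff_expand_sub_sq_le_of_sq {u B : ℚ_[2]⟦X⟧} (hB : IsPadicInt B) (hu : B ^ 2 = u) (n : ℕ) :
    ‖coeff n (expand 2 two_ne_zero u - u ^ 2)‖ ≤ 4⁻¹ := by
  obtain ⟨e, he, hE⟩ := exists_expand_sub_sq_eq_two_mul hB
  have key : expand 2 two_ne_zero u - u ^ 2 = C (4 : ℚ_[2]) * (e * (e + B ^ 2)) := by
    have h1 : expand 2 two_ne_zero u = (expand 2 two_ne_zero B) ^ 2 := by rw [← hu, map_pow]
    have h2 : expand 2 two_ne_zero B = B ^ 2 + 2 * e := by rw [← hE]; ring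
    rw [h1, h2, ← hu, show (C (4 : ℚ_[2]) : ℚ_[2]⟦X⟧) = 4 from map_ofNat C 4]
    ring
  rw [key, coeff_C_mul, norm_mul, show ‖(4 : ℚ_[2])‖ = 4⁻¹ by
    rw [show (4 : ℚ_[2]) = 2 ^ 2 by norm_num, norm_pow, show ‖(2 : ℚ_[2])‖ = 2⁻¹ by simpa using Padic.norm_p (p := 2)]
    norm_num]
  have hint : ‖coeff n (e * (e + B ^ 2))‖ ≤ 1 :=
    isPadicInt_iff_coeff.mp (he.mul (he.add (hB.pow 2))) n
  have : (0 : ℝ) ≤ 4⁻¹ := by norm_num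
  nlinarith [norm_nonneg (coeff n (e * (e + B ^ 2)))]

/-! ### §3 (⇐) `u(q²) ≡ u² (mod 4)` makes every normalised square root integral (Dwork) -/

/-- If `u ∈ 1 + qℤ₂⟦q⟧` satisfies `u(q²) ≡ u(q)² (mod 4)` then any `B` with `B(0) = 1`, `B² = u` lies in `ℤ₂⟦q⟧`.
Proof: `G := B(q²)/u` has `G² = 1 + 4H` with `H` integral, hence `G = 1 + 2t`, `t + t² = H`, `t` integral;
then Dwork's lemma (`B(q²) = B²G`). [this memo, K-ETA.md §4 Lemma 1 (⇐)] [tree: Literature.NumberTheory.LFunctions.Dwork.norm_coeff_le_one_of_expand_eq] -/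
theorem isPadicInt_of_sq_eq {u B : ℚ_[2]⟦X⟧} (hu : IsPadicInt u) (hu0 : constantCoeff u = 1)
    (h4 : ∀ n, ‖coeff n (expand 2 two_ne_zero u - u ^ 2)‖ ≤ 4⁻¹)
    (hB0 : constantCoeff B = 1) (hB : B ^ 2 = u) : IsPadicInt B := by
  have hu_ne : constantCoeff u ≠ 0 := by rw [hu0]; exact one_ne_zero
  set ui : ℚ_[2]⟦X⟧ := u⁻¹ with hui
  have hui_mul : u * ui = 1 := PowerSeries.mul_inv_cancel u hu_ne
  have hui0 : constantCoeff ui = 1 := by rw [hui, constantCoeff_inv, hu0, inv_one]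
  have hui_int : IsPadicInt ui :=
    isPadicInt_iff_coeff.mpr (ModularForms.norm_coeff_inv_le_one (isPadicInt_iff_coeff.mp hu) (by rw [hu0, norm_one]))
  -- `H := (u(q²) − u²)/(4u²)` is integral
  set H : ℚ_[2]⟦X⟧ := C (4⁻¹ : ℚ_[2]) * (expand 2 two_ne_zero u - u ^ 2) * ui ^ 2 with hH
  have hH_int : IsPadicInt H := by
    have h1 : IsPadicInt (C (4⁻¹ : ℚ_[2]) * (expand 2 two_ne_zero u - u ^ 2)) :=
      isPadicInt_iff_coeff.mpr fun n ↦ by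
        rw [coeff_C_mul, norm_mul, norm_inv, show ‖(4 : ℚ_[2])‖ = 4⁻¹ by
          rw [show (4 : ℚ_[2]) = 2 ^ 2 by norm_num, norm_pow, show ‖(2 : ℚ_[2])‖ = 2⁻¹ by simpa using Padic.norm_p (p := 2)]
          norm_num, inv_inv]
        have := h4 n
        linarith
    exact h1.mul (hui_int.pow 2)
  -- `G := B(q²)/u`, `G² = 1 + 4H`
  set G : ℚ_[2]⟦X⟧ := expand 2 two_ne_zero B * ui with hG
  have hG0 : constantCoeff G = 1 := by
    rw [hG, map_mul, constantCoeff_expand, hB0, hui0, one_mul]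
  have hC4 : (4 : ℚ_[2]⟦X⟧) * C (4⁻¹ : ℚ_[2]) = 1 := by
    rw [show (4 : ℚ_[2]⟦X⟧) = C (4 : ℚ_[2]) from (map_ofNat C 4).symm, ← map_mul, mul_inv_cancel₀ (by norm_num : (4 : ℚ_[2]) ≠ 0), map_one]
  have hGsq : G ^ 2 = 1 + 4 * H := by
    have h1 : G ^ 2 = expand 2 two_ne_zero u * ui ^ 2 := by rw [hG, mul_pow, ← map_pow, hB]
    rw [h1, hH, show (4 : ℚ_[2]⟦X⟧) * (C (4⁻¹ : ℚ_[2]) * (expand 2 two_ne_zero u - u ^ 2) * ui ^ 2) =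
      ((4 : ℚ_[2]⟦X⟧) * C (4⁻¹ : ℚ_[2])) * ((expand 2 two_ne_zero u - u ^ 2) * ui ^ 2) by ring, hC4, one_mul]
    linear_combination (u * ui + 1) * hui_mul
  -- `G = 1 + 2t`, `t + t² = H`
  set t : ℚ_[2]⟦X⟧ := C (2⁻¹ : ℚ_[2]) * (G - 1) with ht
  have hC2 : (2 : ℚ_[2]⟦X⟧) * C (2⁻¹ : ℚ_[2]) = 1 := by
    rw [show (2 : ℚ_[2]⟦X⟧) = C (2 : ℚ_[2]) from (map_ofNat C 2).symm, ← map_mul, mul_inv_cancel₀ two_ne_zero, map_one]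
  have hGt : G = 1 + 2 * t := by
    rw [ht, ← mul_assoc, hC2, one_mul]; ring
  have ht0 : constantCoeff t = 0 := by
    rw [ht, map_mul, map_sub, hG0, map_one, sub_self, mul_zero]
  have htH : t + t ^ 2 = H := by
    have hsq : (1 + 2 * t) ^ 2 = 1 + 4 * H := by rw [← hGt, hGsq]
    have h4 : (4 : ℚ_[2]⟦X⟧) * (t + t ^ 2 - H) = 0 := by linear_combination hsq
    have h4ne : (4 : ℚ_[2]⟦X⟧) ≠ 0 := by
      intro h0
      have h44 : constantCoeff (4 : ℚ_[2]⟦X⟧) = (4 : ℚ_[2]) := map_ofNat _ 4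
      rw [h0, map_zero] at h44
      norm_num at h44
    have := (mul_eq_zero.mp h4).resolve_left h4ne
    linear_combination this
  -- `t` is integral, by induction on the coefficients of `t = H − t²`
  have ht_int : IsPadicInt t := by
    refine isPadicInt_iff_coeff.mpr fun n ↦ ?_
    induction n using Nat.strong_induction_on with
    | _ n ih =>
      rcases Nat.eq_zero_or_pos n with rfl | hn
      · rw [coeff_zero_eq_constantCoeff, ht0, norm_zero]; exact zero_le_one
      · have hcoef : coeff n t = coeff n H - coeff n (t ^ 2) := by
          rw [← htH, map_add]; ring
        rw [hcoef, sub_eq_add_neg]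
        refine (IsUltrametricDist.norm_add_le_max _ _).trans (max_le (isPadicInt_iff_coeff.mp hH_int n) ?_)
        rw [norm_neg, sq, coeff_mul]
        refine IsUltrametricDist.norm_sum_le_of_forall_le_of_nonneg zero_le_one fun ij hij ↦ ?_
        rw [Finset.HasAntidiagonal.mem_antidiagonal] at hij
        rw [norm_mul]
        by_cases hi : ij.1 = 0
        · rw [hi, coeff_zero_eq_constantCoeff, ht0, norm_zero, zero_mul]; exact zero_le_one
        by_cases hj : ij.2 = 0
        · rw [hj, coeff_zero_eq_constantCoeff, ht0, norm_zero, mul_zero]; exact zero_le_one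
        exact mul_le_one₀ (ih ij.1 (by omega)) (norm_nonneg _) (ih ij.2 (by omega))
  -- Dwork's lemma
  have hGcoef : ∀ i, 0 < i → ‖coeff i G‖ ≤ ((2 : ℕ) : ℝ)⁻¹ := by
    intro i hi
    rw [hGt, map_add, coeff_one, if_neg hi.ne', zero_add, show (2 : ℚ_[2]⟦X⟧) = C (2 : ℚ_[2]) from (map_ofNat C 2).symm,
      coeff_C_mul, norm_mul, show ‖(2 : ℚ_[2])‖ = 2⁻¹ by simpa using Padic.norm_p (p := 2)]
    have := isPadicInt_iff_coeff.mp ht_int i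
    have h0 : (0 : ℝ) ≤ ‖coeff i t‖ := norm_nonneg _
    push_cast
    nlinarith
  have hFG : expand 2 two_ne_zero B = B ^ 2 * G := by
    rw [hG]
    linear_combination (-(expand 2 two_ne_zero B)) * hui_mul + (-(expand 2 two_ne_zero B) * ui) * hB
  exact isPadicInt_iff_coeff.mpr fun n ↦
    Literature.NumberTheory.LFunctions.Dwork.norm_coeff_le_one_of_expand_eq hB0 hG0 hGcoef hFG n

/-! ### §4 Existence of the normalised square root and the criterion -/

/-- Over `ℚ₂`, every `u` with `u(0) = 1` has a square root `B` with `B(0) = 1` (binomial series). [folklore] -/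
theorem exists_sqrt (u : ℚ_[2]⟦X⟧) (hu0 : constantCoeff u = 1) :
    ∃ B : ℚ_[2]⟦X⟧, constantCoeff B = 1 ∧ B ^ 2 = u := by
  set g : ℚ_[2]⟦X⟧ := u - 1 with hg
  have hg0 : constantCoeff g = 0 := by rw [hg, map_sub, hu0, map_one, sub_self]
  have hgs : HasSubst g := HasSubst.of_constantCoeff_zero' hg0
  set B₀ : ℚ_[2]⟦X⟧ := (PowerSeries.binomialSeries ℚ_[2] (1 / 2 : ℚ)).subst g with hB₀
  have hB₀sq : B₀ ^ 2 = u := by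
    rw [hB₀, ← subst_pow hgs, sq, ← binomialSeries_add,
      show (1 / 2 : ℚ) + 1 / 2 = ((1 : ℕ) : ℚ) by norm_num, binomialSeries_nat, pow_one,
      subst_add hgs, subst_X hgs, ← coe_substAlgHom hgs, map_one, hg]
    ring
  have hc : constantCoeff B₀ = 1 ∨ constantCoeff B₀ = -1 := by
    have h1 : constantCoeff B₀ ^ 2 = 1 ^ 2 := by rw [← map_pow, hB₀sq, hu0, one_pow]
    exact eq_or_eq_neg_of_sq_eq_sq _ _ h1
  rcases hc with h | h
  · exact ⟨B₀, h, hB₀sq⟩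
  · exact ⟨-B₀, by rw [map_neg, h, neg_neg], by rw [neg_sq, hB₀sq]⟩

/-- **The `2`-adic square-class criterion (K-ETA Lemma 1 for `(ℚ₂, ℤ₂, id)`).** For `u ∈ 1 + qℤ₂⟦q⟧`:
`u` is the square of an integral series iff `u(q²) ≡ u(q)² (mod 4ℤ₂⟦q⟧)`.
[this memo, K-ETA.md §4 Lemma 1] [tree: Literature.NumberTheory.LFunctions.Dwork.norm_coeff_le_one_of_expand_eq] -/
theorem isSquare_iff_expand_sub_sq {u : ℚ_[2]⟦X⟧} (hu : IsPadicInt u) (hu0 : constantCoeff u = 1) :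
    (∃ B : ℚ_[2]⟦X⟧, IsPadicInt B ∧ B ^ 2 = u) ↔
      ∀ n, ‖coeff n (expand 2 two_ne_zero u - u ^ 2)‖ ≤ 4⁻¹ := by
  constructor
  · rintro ⟨B, hB, hBu⟩ n
    exact norm_coeff_expand_sub_sq_le_of_sq hB hBu n
  · intro h4
    obtain ⟨B, hB0, hB⟩ := exists_sqrt u hu0
    exact ⟨B, isPadicInt_of_sq_eq hu hu0 h4 hB0 hB, hB⟩

/-- The same criterion with a NORMALISED root: `u(q²) ≡ u² (mod 4)` iff some (equivalently every) square root `B`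
with `B(0) = 1` is integral. [this memo, K-ETA.md §4 Lemma 1] -/
theorem isSquare_iff_expand_sub_sq' {u : ℚ_[2]⟦X⟧} (hu : IsPadicInt u) (hu0 : constantCoeff u = 1) :
    (∃ B : ℚ_[2]⟦X⟧, constantCoeff B = 1 ∧ IsPadicInt B ∧ B ^ 2 = u) ↔
      ∀ n, ‖coeff n (expand 2 two_ne_zero u - u ^ 2)‖ ≤ 4⁻¹ := by
  constructor
  · rintro ⟨B, -, hB, hBu⟩ n
    exact norm_coeff_expand_sub_sq_le_of_sq hB hBu n
  · intro h4
    obtain ⟨B, hB0, hB⟩ := exists_sqrt u hu0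
    exact ⟨B, hB0, isPadicInt_of_sq_eq hu hu0 h4 hB0 hB, hB⟩

/-! ### §5 The relative form: `u·v` is a square iff `u(q²)v² ≡ u²v(q²) (mod 4)` (`D(u) = D(v)`) -/

/-- Shifting by `4·(integral)` does not change the `mod 4` condition. [folklore] -/
theorem norm_coeff_le_quarter_of_eq_add_four_mul {P Q Y : ℚ_[2]⟦X⟧} (hY : IsPadicInt Y)
    (hPQ : P = Q + 4 * Y) (n : ℕ) (hQ : ‖coeff n Q‖ ≤ 4⁻¹) : ‖coeff n P‖ ≤ 4⁻¹ := by
  rw [hPQ, map_add, show (4 : ℚ_[2]⟦X⟧) = C (4 : ℚ_[2]) from (map_ofNat C 4).symm, coeff_C_mul]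
  refine (IsUltrametricDist.norm_add_le_max _ _).trans (max_le hQ ?_)
  rw [norm_mul, show ‖(4 : ℚ_[2])‖ = 4⁻¹ by
    rw [show (4 : ℚ_[2]) = 2 ^ 2 by norm_num, norm_pow, show ‖(2 : ℚ_[2])‖ = 2⁻¹ by simpa using Padic.norm_p (p := 2)]
    norm_num]
  have := isPadicInt_iff_coeff.mp hY n
  have h0 : (0 : ℝ) ≤ ‖coeff n Y‖ := norm_nonneg _
  nlinarith

/-- **Relative square-class criterion (`D(uv) = D(u) + D(v)`).** For `u, v ∈ 1 + qℤ₂⟦q⟧`: `u·v` is the square of an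
integral series iff `u(q²)·v² ≡ u²·v(q²) (mod 4ℤ₂⟦q⟧)` — the form in which the η-Kummer law is checked
(`Θ_N(q²)·V² ≡ Θ_N²·V(q²)`, K-ETA.md §3/§4). [this memo, K-ETA.md §4 Lemma 1] -/
theorem isSquare_mul_iff {u v : ℚ_[2]⟦X⟧} (hu : IsPadicInt u) (hu0 : constantCoeff u = 1)
    (hv : IsPadicInt v) (hv0 : constantCoeff v = 1) :
    (∃ B : ℚ_[2]⟦X⟧, IsPadicInt B ∧ B ^ 2 = u * v) ↔
      ∀ n, ‖coeff n (expand 2 two_ne_zero u * v ^ 2 - u ^ 2 * expand 2 two_ne_zero v)‖ ≤ 4⁻¹ := by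
  have huv : IsPadicInt (u * v) := hu.mul hv
  have huv0 : constantCoeff (u * v) = 1 := by rw [map_mul, hu0, hv0, one_mul]
  rw [isSquare_iff_expand_sub_sq huv huv0]
  -- `u(q²) = u² + 2e`, `v(q²) = v² + 2e'`
  obtain ⟨e, he, hE⟩ := exists_expand_sub_sq_eq_two_mul hu
  obtain ⟨e', he', hE'⟩ := exists_expand_sub_sq_eq_two_mul hv
  have ha : expand 2 two_ne_zero u = u ^ 2 + 2 * e := by rw [← hE]; ring
  have hb : expand 2 two_ne_zero v = v ^ 2 + 2 * e' := by rw [← hE']; ring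
  -- the two `mod 4` quantities differ by `4e'(u² + e)`
  have hdiff : expand 2 two_ne_zero (u * v) - (u * v) ^ 2 =
      (expand 2 two_ne_zero u * v ^ 2 - u ^ 2 * expand 2 two_ne_zero v) + 4 * (e' * (u ^ 2 + e)) := by
    rw [map_mul, ha, hb]; ring
  have hdiff' : expand 2 two_ne_zero u * v ^ 2 - u ^ 2 * expand 2 two_ne_zero v =
      (expand 2 two_ne_zero (u * v) - (u * v) ^ 2) + 4 * (-(e' * (u ^ 2 + e))) := by
    rw [hdiff]; ring
  have hY : IsPadicInt (e' * (u ^ 2 + e)) := he'.mul ((hu.pow 2).add he)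
  constructor
  · intro h n
    exact norm_coeff_le_quarter_of_eq_add_four_mul hY.neg hdiff' n (h n)
  · intro h n
    exact norm_coeff_le_quarter_of_eq_add_four_mul hY hdiff n (h n)

end Summit.BirchSwinnertonDyer.BirchSwinnertonDyer.Theorems.DepletionAtTwo.KEta.SqClass

end
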